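import Summits.CriticalPhenomena.PercolationContinuityZ3.Theorems.PercNearOneGluingNoHeavyConj1ShapeOptimal
import HarnessLib

/-!
# The SHARP threshold of Kozma–Nitzan's Conjecture 3 (`NearOneGluing`): `δ*(ε) = 1 − √(1 − ε)`

builds on p205010 (kernel theorem, internal audit signed; external expert review pending)

PAPER-2 track "percolation constants", part (ii) (explicit constants across the CSH inequality family), seat `prim-consts-2`
(sharpening).  Support file (`--supports stmt-CriticalPhenomena-4575`); no definitions, no named facts, no sorries.

The route decl `NearOneGluing` (= Kozma–Nitzan's Conjecture 3, arXiv:2401.12397 p. 15) is an `∀ ε ∃ δ` statement.  The tree proves it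
with `δ = ε/2` (`additiveGluingSuffices_proof`, from `AdditiveGluing`) and with `δ = min (ε/2) (1/2)`
(`Literature.….kozmaNitzan2024_conjecture3_of_conjecture1`).  Kozma–Nitzan themselves remark (p. 15) that Conjecture 1 gives
`δ = 1 − √(1−ε)`.  Since Conjecture 1 is a theorem of the tree (`kozmaNitzan2024_conjecture1_holds`, on p205010's chain), the
EXACT set of admissible `δ` at every level `ε ∈ [0,1]` can now be written down:

* `Consts.nearOneGluingAt_of_le_sharpDelta` — for EVERY real `ε` and every `δ ≤ 1 − √(1−ε)`, the `(ε, δ)` instance of Conjecture 3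
  holds on every finite weighted graph (from Conjecture 1 with the common lower bound `t = min_{a ∈ A} P(a ↔ b)`);
* `Consts.nearOneGluingAt_witness` — for `0 ≤ ε ≤ 1` and every `δ > 1 − √(1−ε)` the series graph `o – a – b` with both weights
  `√(1−ε)` satisfies the hypotheses (`P(o ↔ A) = P(a ↔ b) = √(1−ε) > 1 − δ`) and violates the conclusion (`P(o ↔ b) = 1 − ε`);
* `Consts.nearOneGluingAt_iff` — hence for `0 ≤ ε ≤ 1`:  the `(ε, δ)` instance holds for all graphs  **iff**  `δ ≤ 1 − √(1−ε)`;
* `Consts.half_lt_sharpDelta` — `ε/2 < 1 − √(1−ε)` for `0 < ε < 2`: the sharp threshold strictly improves the tree's `ε/2`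
  (by the factor `(1 − √(1−ε))/(ε/2) ∈ (1, 2]`, `→ 1` as `ε → 0`, `= 2` at `ε = 1`);
* (the route decl `NearOneGluing` itself is already closed — `NearOneGluing_proof'`; `nearOneGluingAt_of_le_sharpDelta le_rfl` is its
  `δ(ε) = 1 − √(1−ε)` witness, positive for every `ε > 0`.)

So in the data `(ε, δ)` the near-one gluing statement cannot be improved: the constant is sharp and the extremiser has three vertices.

References: G. Kozma, N. Nitzan, arXiv:2401.12397 (2024), Conjecture 1 (p. 3), Conjecture 3 and the remark after it (p. 15).
-/

noncomputable section

namespace Summit.CriticalPhenomena.PercolationContinuityZ3.Theorems.Consts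

open MeasureTheory Literature.Probability.Percolation Literature.Probability.LatticeModels

/-- `1 − ε ≤ (√(1−ε))²` for every real `ε` (equality when `ε ≤ 1`). [folklore] -/
theorem one_sub_le_sqrt_sq (ε : ℝ) : 1 - ε ≤ Real.sqrt (1 - ε) ^ 2 := by
  rcases le_or_gt 0 (1 - ε) with h | h
  · rw [Real.sq_sqrt h]
  · exact h.le.trans (sq_nonneg _)

/-- **Conjecture 3 holds at `(ε, δ)` whenever `δ ≤ 1 − √(1−ε)`** (every real `ε`; every finite weighted graph, every relay set):
if `P(o ↔ A) > 1 − δ` and `P(a ↔ b) > 1 − δ` for all `a ∈ A` then `P(o ↔ b) > 1 − ε`.  Proof: Kozma–Nitzan's Conjecture 1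
(a tree theorem) with `t = min_a P(a ↔ b)` gives `P(o ↔ b) ≥ P(o ↔ A)·t > (1−δ)² ≥ 1 − ε` (strictly, also at `√(1−ε) = 0`).
[cite: KozmaNitzan2024, p. 15 (remark after Conjecture 3)] -/
theorem nearOneGluingAt_of_le_sharpDelta {ε δ : ℝ} (hδ : δ ≤ 1 - Real.sqrt (1 - ε)) :
    ∀ (n : ℕ) (w : Sym2 (Fin n) → unitInterval) (A : Finset (Fin n)) (o b : Fin n),
      1 - δ < (prodBernoulli w).real (⋃ a ∈ A, openConn o a) →
      (∀ a ∈ A, 1 - δ < (prodBernoulli w).real (openConn a b)) →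
      1 - ε < (prodBernoulli w).real (openConn o b) := by
  intro n w A o b hoA hab
  set s : ℝ := Real.sqrt (1 - ε) with hs
  have hs0 : 0 ≤ s := Real.sqrt_nonneg _
  have hsδ : s ≤ 1 - δ := by linarith
  -- the relay set is nonempty (otherwise `P(o ↔ ∅) = 0 > 1 - δ ≥ 0`)
  have hAne : A.Nonempty := by
    rcases A.eq_empty_or_nonempty with hAe | hAne
    · subst hAe
      simp only [Finset.notMem_empty, Set.iUnion_of_empty, Set.iUnion_empty, measureReal_empty] at hoA
      linarith
    · exact hAne
  -- the smallest relay-to-target probability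
  obtain ⟨a₀, ha₀, hmin⟩ := A.exists_min_image (fun a => (prodBernoulli w).real (openConn a b)) hAne
  set t : ℝ := (prodBernoulli w).real (openConn a₀ b) with ht
  have htlt : 1 - δ < t := hab a₀ ha₀
  have key := kozmaNitzan2024_conjecture1_holds n w A o b t fun a ha => hmin a ha
  -- `P(o ↔ A) > s ≥ 0` and `t > s ≥ 0`
  have hP : s < (prodBernoulli w).real (⋃ a ∈ A, openConn o a) := lt_of_le_of_lt hsδ hoA
  have htgt : s < t := lt_of_le_of_lt hsδ htlt
  have hPpos : 0 < (prodBernoulli w).real (⋃ a ∈ A, openConn o a) := lt_of_le_of_lt hs0 hP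
  have hprod : s * s < (prodBernoulli w).real (⋃ a ∈ A, openConn o a) * t :=
    calc s * s ≤ (prodBernoulli w).real (⋃ a ∈ A, openConn o a) * s :=
          mul_le_mul_of_nonneg_right hP.le hs0
      _ < (prodBernoulli w).real (⋃ a ∈ A, openConn o a) * t := mul_lt_mul_of_pos_left htgt hPpos
  have hsq : 1 - ε ≤ s * s := by rw [← sq]; exact one_sub_le_sqrt_sq ε
  linarith

/-- **The extremiser**: for `0 ≤ ε ≤ 1` and `δ > 1 − √(1−ε)`, the series graph `o – a – b` on `Fin 3` with both weights `√(1−ε)`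
has `P(o ↔ A) = √(1−ε) > 1 − δ` (`A = {a}`), `P(a ↔ b) = √(1−ε) > 1 − δ` and `P(o ↔ b) = 1 − ε`, so the `(ε, δ)` instance of
Conjecture 3 FAILS. [cite: KozmaNitzan2024, p. 15 (remark after Conjecture 3)] -/
theorem nearOneGluingAt_witness {ε δ : ℝ} (hε0 : 0 ≤ ε) (hε1 : ε ≤ 1) (hδ : 1 - Real.sqrt (1 - ε) < δ) :
    ∃ (n : ℕ) (w : Sym2 (Fin n) → unitInterval) (A : Finset (Fin n)) (o b : Fin n),
      1 - δ < (prodBernoulli w).real (⋃ a ∈ A, openConn o a) ∧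
      (∀ a ∈ A, 1 - δ < (prodBernoulli w).real (openConn a b)) ∧
      (prodBernoulli w).real (openConn o b) ≤ 1 - ε := by
  have hq0 : 0 ≤ Real.sqrt (1 - ε) := Real.sqrt_nonneg _
  have hq1 : Real.sqrt (1 - ε) ≤ 1 := by
    rw [Real.sqrt_le_one]
    linarith
  set q : unitInterval := ⟨Real.sqrt (1 - ε), hq0, hq1⟩ with hq
  refine ⟨3, fun e : Sym2 (Fin 3) => if e = s(0, 1) then q else if e = s(1, 2) then q else 0, {1}, 0, 2, ?_, ?_, ?_⟩
  · rw [RSW3.SeriesGraph.real_iUnion_openConn_zero_relay]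
    change 1 - δ < Real.sqrt (1 - ε)
    linarith
  · intro a ha
    rw [Finset.mem_singleton] at ha
    subst ha
    rw [RSW3.SeriesGraph.real_openConn_one_two]
    change 1 - δ < Real.sqrt (1 - ε)
    linarith
  · rw [RSW3.SeriesGraph.real_openConn_zero_two]
    change Real.sqrt (1 - ε) * Real.sqrt (1 - ε) ≤ 1 - ε
    rw [Real.mul_self_sqrt (by linarith)]

/-- **THE SHARP THRESHOLD OF CONJECTURE 3.**  For `0 ≤ ε ≤ 1`: the `(ε, δ)` instance of Kozma–Nitzan's Conjecture 3 holds on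
every finite weighted graph **iff** `δ ≤ 1 − √(1−ε)`.  (The tree's chain used `δ = ε/2 < 1 − √(1−ε)`.)
[cite: KozmaNitzan2024, Conjecture 3 (p. 15)] -/
theorem nearOneGluingAt_iff {ε δ : ℝ} (hε0 : 0 ≤ ε) (hε1 : ε ≤ 1) :
    (∀ (n : ℕ) (w : Sym2 (Fin n) → unitInterval) (A : Finset (Fin n)) (o b : Fin n),
      1 - δ < (prodBernoulli w).real (⋃ a ∈ A, openConn o a) →
      (∀ a ∈ A, 1 - δ < (prodBernoulli w).real (openConn a b)) →
      1 - ε < (prodBernoulli w).real (openConn o b)) ↔ δ ≤ 1 - Real.sqrt (1 - ε) := by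
  constructor
  · intro h
    by_contra hlt
    push Not at hlt
    obtain ⟨n, w, A, o, b, hoA, hab, hob⟩ := nearOneGluingAt_witness hε0 hε1 hlt
    exact absurd (h n w A o b hoA hab) (not_lt.2 hob)
  · exact fun hδ => nearOneGluingAt_of_le_sharpDelta hδ

/-- `ε/2 < 1 − √(1−ε)` for `0 < ε < 2`: the sharp threshold strictly beats the tree's `δ = ε/2`. [folklore] -/
theorem half_lt_sharpDelta {ε : ℝ} (hε0 : 0 < ε) (hε2 : ε < 2) : ε / 2 < 1 - Real.sqrt (1 - ε) := by
  have h1 : 0 < 1 - ε / 2 := by linarith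
  have key : Real.sqrt (1 - ε) < 1 - ε / 2 := by
    rw [Real.sqrt_lt' h1]
    nlinarith
  linarith

/-- `1 − √(1−ε) ≤ ε` for `0 ≤ ε ≤ 1` (so the sharp threshold lies in `(ε/2, ε]`). [folklore] -/
theorem sharpDelta_le {ε : ℝ} (hε0 : 0 ≤ ε) (hε1 : ε ≤ 1) : 1 - Real.sqrt (1 - ε) ≤ ε := by
  have h : 1 - ε ≤ Real.sqrt (1 - ε) := by
    have h1 : 0 ≤ 1 - ε := by linarith
    calc 1 - ε = Real.sqrt (1 - ε) * Real.sqrt (1 - ε) := (Real.mul_self_sqrt h1).symm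
      _ ≤ Real.sqrt (1 - ε) * 1 :=
          mul_le_mul_of_nonneg_left ((Real.sqrt_le_one).2 (by linarith)) (Real.sqrt_nonneg _)
      _ = Real.sqrt (1 - ε) := mul_one _
  linarith

end Summit.CriticalPhenomena.PercolationContinuityZ3.Theorems.Consts

end
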